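/-
Copyright (c) 2026. All rights reserved.
Released under Apache 2.0 license as described in the file LICENSE.
-/
import Literature.NumberTheory.PAdicHodge.UnramifiedWittVectors
import Literature.NumberTheory.PAdicHodge.FontaineThetaKernel
import Literature.NumberTheory.PAdicHodge.CompletedAlgClosureAlgClosed
import HarnessLib

/-!
# The residue field `k_C = 𝒪_{ℂ_F}/𝔪_C` and the specialisation `𝔸_inf(F) → W(k_C)`

Solo/informed seat, programme Λ (statement repair D2-cris, input (I2) `B_max(F)^{Γ_F} = F₀`, untwisted
layer `(A_max)^{Γ_F} = W(k_F)`): file Λ1a.  The tool replacing Fontaine's `θ` (which is RAMIFIED on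
`(A_max)^{Γ_F}`, see the seat's notes A167/A168) is the UNRAMIFIED specialisation

  `λ : A_max = B_max⁺(F) → W(k_C)`,   `k_C := 𝒪_{ℂ_F}/𝔪_C`,

the `p`-adically continuous extension of `W(π) : 𝔸_inf(F) = W(𝒪_{ℂ_F}♭) → W(k_C)` where
`π : 𝒪_{ℂ_F}♭ → k_C` reduces the `0`-th component modulo `𝔪_C`; it exists because `W(π)(ξ) = -p`
(`(p♭)₀ = 0`), so `W(π)(ξ/p) = -1` is integral.  This file builds the residue side:

* §1 `𝒪_{ℂ_F}` is a local ring (`isLocalRing_integerC`; units = norm-one elements,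
  `isUnit_integerC_iff`), `𝔪_C = {‖x‖ < 1} ∋ p` (`mem_maximalIdeal_integerC_iff`), and its residue field
  `k_C` is a perfect field of characteristic `p` (`charP_residueField_integerC`,
  `perfectRing_residueField_integerC`: `p`-th roots exist in the algebraically closed field `ℂ_F`);
  `Γ_F` acts on `k_C` (`galResidueC`, through the local homomorphisms `galInt σ`).
* §2 `π = tiltResidue : 𝒪_{ℂ_F}♭ → k_C` and `W(π) = ainfResidue : 𝔸_inf(F) → W(k_C)`, with
  `tiltResidue_pFlat : π(p♭) = 0`, **`ainfResidue_xi : W(π)(ξ) = -p`**, and `Γ_F`-equivariance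
  (`tiltResidue_galTilt`, `ainfResidue_galAinf`).
* §3 the composite `j = residueToResidueC : k̄ → k_C` (`k̄` the residue field of `𝒪̂_{F^nr}`, through the
  tilt of `ι₀ : 𝒪̂_{F^nr} → 𝒪_{ℂ_F}`), with **`ainfResidue_wittToAinf : W(π) ∘ (W(k̄) → 𝔸_inf) = W(j)`**,
  its `Γ_F`-equivariance `residueToResidueC_residueGal` and injectivity.

File Λ1b (`SoloInformedBmaxPlusSpecialisation`) extends `W(π)` to `B⁰_max` and `B_max⁺`; file Λ2 combines
it with `SoloInformedWittIntegralRange` (`W(k̄) ⊆ W(k_C)` is integrally closed for Witt-polynomial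
relations) to compute `(A_max)^{Γ_F}`.

References: Fontaine, *Le corps des périodes p-adiques*, Astérisque 223 (1994), Exp. II §1.2;
Colmez, Ann. of Math. 148 (1998), §III.2; Serre, *Local Fields*, Ch. II §4–§5.
-/

noncomputable section

open WittVector Field IsLocalRing ValuativeRel
open Literature.NumberTheory.GaloisRepresentations Literature.NumberTheory.PAdicHodge
open Literature.NumberTheory.GaloisRepresentations.IsNonarchimedeanLocalField

namespace Summit.Langlands.Langlands.Theorems

namespace SpecC

variable {F : Type} [Field F] [ValuativeRel F] [TopologicalSpace F] [IsNonarchimedeanLocalField F]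

/-! ### §1 `𝒪_{ℂ_F}` is a local ring; its residue field `k_C` -/

/-- **Units of `𝒪_{ℂ_F}` are the elements of norm `1`.** [cite: FontaineOuyang2022, §3.1] -/
theorem isUnit_integerC_iff (x : integerC F) : IsUnit x ↔ ‖(x : CompletedAlgClosure F)‖ = 1 := by
  constructor
  · rintro ⟨u, rfl⟩
    have h1 := norm_coe_integerC_le (u : integerC F)
    have h2 := norm_coe_integerC_le ((u⁻¹ : (integerC F)ˣ) : integerC F)
    have h3 : ‖((u : integerC F) : CompletedAlgClosure F)‖ *
        ‖(((u⁻¹ : (integerC F)ˣ) : integerC F) : CompletedAlgClosure F)‖ = 1 := by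
      rw [← norm_mul, ← Subring.coe_mul, Units.mul_inv, Subring.coe_one, norm_one]
    refine le_antisymm h1 (not_lt.1 fun hlt => ?_)
    exact (mul_lt_one_of_nonneg_of_lt_one_left (norm_nonneg _) hlt h2).ne h3
  · intro h
    have hx0 : (x : CompletedAlgClosure F) ≠ 0 := fun h0 => by
      rw [h0, norm_zero] at h; exact zero_ne_one h
    refine ⟨⟨x, ⟨(x : CompletedAlgClosure F)⁻¹, ?_⟩, Subtype.ext ?_, Subtype.ext ?_⟩, rfl⟩
    · rw [mem_integerC_iff, norm_inv, h, inv_one]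
    · change (x : CompletedAlgClosure F) * (x : CompletedAlgClosure F)⁻¹ = 1
      rw [mul_inv_cancel₀ hx0]
    · change (x : CompletedAlgClosure F)⁻¹ * (x : CompletedAlgClosure F) = 1
      rw [inv_mul_cancel₀ hx0]

/-- Non-units of `𝒪_{ℂ_F}` are the elements of norm `< 1`. [cite: FontaineOuyang2022, §3.1] -/
theorem norm_coe_integerC_lt_one_iff (x : integerC F) : ‖(x : CompletedAlgClosure F)‖ < 1 ↔ ¬ IsUnit x := by
  rw [isUnit_integerC_iff]
  exact ⟨fun h => h.ne, fun h => lt_of_le_of_ne (norm_coe_integerC_le x) h⟩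

/-- **`𝒪_{ℂ_F}` is a local ring** (if `‖a‖ < 1` then `‖1 - a‖ = 1`). [cite: FontaineOuyang2022, §3.1] -/
instance isLocalRing_integerC : IsLocalRing (integerC F) :=
  IsLocalRing.of_isUnit_or_isUnit_one_sub_self fun a => by
    by_cases ha : IsUnit a
    · exact Or.inl ha
    · refine Or.inr ((isUnit_integerC_iff _).2 ?_)
      have hlt : ‖(a : CompletedAlgClosure F)‖ < 1 := (norm_coe_integerC_lt_one_iff a).2 ha
      have hne : ‖(1 : CompletedAlgClosure F)‖ ≠ ‖-(a : CompletedAlgClosure F)‖ := by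
        rw [norm_one, norm_neg]; exact hlt.ne'
      change ‖(1 : CompletedAlgClosure F) - (a : CompletedAlgClosure F)‖ = 1
      rw [sub_eq_add_neg, IsUltrametricDist.norm_add_eq_max_of_norm_ne_norm hne, norm_one, norm_neg,
        max_eq_left hlt.le]

/-- **`𝔪_C = {x : ‖x‖ < 1}`.** [cite: FontaineOuyang2022, §3.1] -/
theorem mem_maximalIdeal_integerC_iff (x : integerC F) :
    x ∈ maximalIdeal (integerC F) ↔ ‖(x : CompletedAlgClosure F)‖ < 1 := by
  rw [IsLocalRing.mem_maximalIdeal, mem_nonunits_iff, norm_coe_integerC_lt_one_iff]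

/-- `σ ∈ Γ_F` acts on `𝒪_{ℂ_F}` by a local homomorphism (it is an isometry). [cite: FontaineOuyang2022, §3.1] -/
instance isLocalHom_galInt (σ : absoluteGaloisGroup F) : IsLocalHom (galInt σ) :=
  ⟨fun a ha => by
    rw [isUnit_integerC_iff] at ha ⊢
    rwa [coe_galInt, CompletedAlgClosure.norm_smul] at ha⟩

/-- **The action of `σ ∈ Γ_F` on the residue field `k_C = 𝒪_{ℂ_F}/𝔪_C`.** [cite: FontaineOuyang2022, §3.1] -/
def galResidueC (σ : absoluteGaloisGroup F) : ResidueField (integerC F) →+* ResidueField (integerC F) :=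
  IsLocalRing.ResidueField.map (galInt σ)

/-- `σ̄ (res x) = res (σ x)`. [folklore] -/
@[simp] theorem galResidueC_residue (σ : absoluteGaloisGroup F) (x : integerC F) :
    galResidueC σ (residue (integerC F) x) = residue (integerC F) (galInt σ x) := rfl

variable {p : ℕ} [Fact p.Prime]

section CharP

variable [Fact (¬ IsUnit (p : integerC F))]

omit [Fact p.Prime] in
/-- `p ∈ 𝔪_C`. [folklore] -/
theorem natCast_mem_maximalIdeal_integerC : (p : integerC F) ∈ maximalIdeal (integerC F) :=
  (IsLocalRing.mem_maximalIdeal _).2 (Fact.out : ¬ IsUnit (p : integerC F))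

omit [Fact p.Prime] in
/-- `(p) ≤ 𝔪_C`. [folklore] -/
theorem span_natCast_le_maximalIdeal_integerC : Ideal.span {(p : integerC F)} ≤ maximalIdeal (integerC F) := by
  rw [Ideal.span_le, Set.singleton_subset_iff]
  exact natCast_mem_maximalIdeal_integerC

/-- **`k_C` has characteristic `p`** (a theorem, not an instance: `p` is not determined by the ring; the files below take
`[CharP k_C p]` as an instance argument, discharged by this theorem). [cite: FontaineOuyang2022, §3.1] -/
theorem charP_residueField_integerC : CharP (ResidueField (integerC F)) p :=
  (CharP.charP_iff_prime_eq_zero (Fact.out : p.Prime)).2 (by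
    rw [← map_natCast (residue (integerC F)), IsLocalRing.residue_eq_zero_iff]
    exact natCast_mem_maximalIdeal_integerC)

end CharP

/-- **`k_C` is perfect**: every element of `𝒪_{ℂ_F}` has a `p`-th root in `𝒪_{ℂ_F}` (`ℂ_F` is algebraically closed
and the root has norm `≤ 1`). [cite: FontaineOuyang2022, §3.1] -/
theorem frobenius_residueField_integerC_surjective [CharZero F] [CharP (ResidueField (integerC F)) p] :
    Function.Surjective (_root_.frobenius (ResidueField (integerC F)) p) := fun y => by
  obtain ⟨x, rfl⟩ := IsLocalRing.residue_surjective y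
  haveI := CompletedAlgClosure.isAlgClosed (F := F)
  obtain ⟨z, hz⟩ := IsAlgClosed.exists_pow_nat_eq (x : CompletedAlgClosure F) (Fact.out : p.Prime).pos
  have hz1 : ‖z‖ ≤ 1 := by
    have h := norm_coe_integerC_le x
    rw [← hz, norm_pow] at h
    exact (pow_le_one_iff_of_nonneg (norm_nonneg z) (Fact.out : p.Prime).ne_zero).1 h
  refine ⟨residue (integerC F) ⟨z, hz1⟩, ?_⟩
  rw [_root_.frobenius_def, ← map_pow]
  congr 1
  exact Subtype.ext (by rw [SubmonoidClass.coe_pow]; exact hz)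

/-- **`k_C` is a perfect ring of characteristic `p`.** [cite: FontaineOuyang2022, §3.1] -/
instance perfectRing_residueField_integerC [CharZero F] [CharP (ResidueField (integerC F)) p] :
    PerfectRing (ResidueField (integerC F)) p :=
  PerfectRing.ofSurjective _ _ frobenius_residueField_integerC_surjective

/-! ### §2 `π : 𝒪_{ℂ_F}♭ → k_C` and `W(π) : 𝔸_inf(F) → W(k_C)` -/

variable [Fact (¬ IsUnit (p : integerC F))]

/-- `𝒪_{ℂ_F}/p → k_C` (`(p) ≤ 𝔪_C`). [folklore] -/
def modPToResidueC : ModP (integerC F) p →+* ResidueField (integerC F) :=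
  Ideal.Quotient.lift (Ideal.span {(p : integerC F)}) (residue (integerC F)) fun _ ha =>
    (IsLocalRing.residue_eq_zero_iff _).2 (span_natCast_le_maximalIdeal_integerC ha)

omit [Fact p.Prime] in
/-- `modPToResidueC` on residue classes. [folklore] -/
@[simp] theorem modPToResidueC_mk (x : integerC F) :
    modPToResidueC (Ideal.Quotient.mk (Ideal.span {(p : integerC F)}) x) = residue (integerC F) x := rfl

variable (F p) in
/-- **`π : 𝒪_{ℂ_F}♭ → k_C`**, `x ↦ x₀ mod 𝔪_C` (a ring homomorphism: the `0`-th projection of the perfection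
followed by `𝒪_{ℂ_F}/p → k_C`). [cite: FontaineAsterisque223III, Exp. II §1.2] -/
def tiltResidue : PreTilt (integerC F) p →+* ResidueField (integerC F) :=
  (modPToResidueC (F := F) (p := p)).comp (PreTilt.coeff 0)

/-- Unfolding of `π`. [folklore] -/
theorem tiltResidue_apply (x : PreTilt (integerC F) p) :
    tiltResidue F p x = modPToResidueC (PreTilt.coeff 0 x) := rfl

/-- **`π(p♭) = 0`** (`(p♭)₀ = p ≡ 0`). [cite: FontaineAsterisque223III, Exp. II §1.2.2] -/
theorem tiltResidue_pFlat : tiltResidue F p (pFlat : PreTilt (integerC F) p) = 0 := by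
  rw [tiltResidue_apply, coeff_zero_pFlat, map_zero]

/-- **`π` is `Γ_F`-equivariant**: `π (σ♭ x) = σ̄ (π x)`. [cite: FontaineAsterisque223III, Exp. II §1.2] -/
theorem tiltResidue_galTilt (σ : absoluteGaloisGroup F) (x : PreTilt (integerC F) p) :
    tiltResidue F p (galTilt σ x) = galResidueC σ (tiltResidue F p x) := by
  rw [tiltResidue_apply, tiltResidue_apply, coeff_galTilt]
  obtain ⟨y, hy⟩ := Ideal.Quotient.mk_surjective (PreTilt.coeff 0 x)
  rw [← hy, galModP_mk, modPToResidueC_mk, modPToResidueC_mk, galResidueC_residue]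

variable (F p) in
/-- **`W(π) : 𝔸_inf(F) = W(𝒪_{ℂ_F}♭) → W(k_C)`** (Witt functoriality). [cite: FontaineAsterisque223III, Exp. II §1.2] -/
def ainfResidue : Ainf (p := p) F →+* WittVector p (ResidueField (integerC F)) :=
  WittVector.map (tiltResidue F p)

/-- Witt coefficients of `W(π) x`. [folklore] -/
@[simp] theorem coeff_ainfResidue (x : Ainf (p := p) F) (n : ℕ) :
    (ainfResidue F p x).coeff n = tiltResidue F p (x.coeff n) :=
  WittVector.map_coeff _ _ _

/-- `W(π)` on Teichmüller representatives. [folklore] -/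
theorem ainfResidue_teichmuller (x : PreTilt (integerC F) p) :
    ainfResidue F p (teichmuller p x) = teichmuller p (tiltResidue F p x) :=
  WittVector.map_teichmuller _ _ _

/-- **`W(π)(ξ) = -p`** (`ξ = [p♭] - p` and `π(p♭) = 0`): the key to extending `W(π)` over `ξ/p`.
[cite: FontaineAsterisque223III, Exp. II §1.2.2] -/
theorem ainfResidue_xi : ainfResidue F p (xi : Ainf (p := p) F) = -(p : WittVector p (ResidueField (integerC F))) := by
  rw [xi_def, map_sub, ainfResidue_teichmuller, tiltResidue_pFlat, teichmuller_zero, map_natCast, zero_sub]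

/-- **`W(π)` is `Γ_F`-equivariant**: `W(π) (𝕎(σ♭) x) = 𝕎(σ̄) (W(π) x)`. [cite: FontaineAsterisque223III, Exp. II §1.2] -/
theorem ainfResidue_galAinf (σ : absoluteGaloisGroup F) (x : Ainf (p := p) F) :
    ainfResidue F p (galAinf σ x) = WittVector.map (galResidueC σ) (ainfResidue F p x) := by
  refine WittVector.ext fun n => ?_
  rw [coeff_ainfResidue, coeff_galAinf, WittVector.map_coeff, coeff_ainfResidue, tiltResidue_galTilt]

omit [Fact (¬ IsUnit (p : integerC F))] in
/-- `W(k_C)` is `p`-adically separated: an element divisible by every power of `p` vanishes. [folklore] -/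
theorem eq_zero_of_forall_mem_span_pow_witt [CharZero F] [CharP (ResidueField (integerC F)) p] {x : WittVector p (ResidueField (integerC F))}
    (h : ∀ n, x ∈ Ideal.span {(p : WittVector p (ResidueField (integerC F)))} ^ n) : x = 0 :=
  IsHausdorff.haus (IsAdicComplete.toIsHausdorff (I := Ideal.span {(p : WittVector p (ResidueField (integerC F)))})) x
    fun n => by rw [smul_eq_mul, Ideal.mul_top]; exact SModEq.zero.2 (h n)

omit [Fact (¬ IsUnit (p : integerC F))] in
/-- `p ≠ 0` in `W(k_C)`, and `W(k_C)` is a domain: `p` is a non-zero-divisor. [folklore] -/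
theorem natCast_witt_mem_nonZeroDivisors [CharZero F] [CharP (ResidueField (integerC F)) p] :
    (p : WittVector p (ResidueField (integerC F))) ∈ nonZeroDivisors (WittVector p (ResidueField (integerC F))) :=
  mem_nonZeroDivisors_of_ne_zero (WittVector.p_nonzero p (ResidueField (integerC F)))

/-! ### §3 `j : k̄ → k_C` and `W(π) ∘ (W(k̄) → 𝔸_inf(F)) = W(j)` -/

section Unramified

variable [CharZero F] [Fact (¬ IsUnit (p : maxUnramifiedCompletion F))]
  [CharP (ResidueField (maxUnramifiedCompletion F)) p]

variable (F p) in
/-- **`j : k̄ → k_C`**, the composite `k̄ ≃ (𝒪̂_{F^nr})♭ → 𝒪_{ℂ_F}♭ → k_C` (tilt of `ι₀ : 𝒪̂_{F^nr} → 𝒪_{ℂ_F}`, then `π`);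
an injective homomorphism of fields. [cite: FontaineAsterisque223III, Exp. II §1.2] -/
def residueToResidueC : ResidueField (maxUnramifiedCompletion F) →+* ResidueField (integerC F) :=
  (tiltResidue F p).comp ((tiltMap p (toCInt₀ F)).comp (residueTiltEquiv F p).toRingHom)

/-- Unfolding of `j`. [folklore] -/
theorem residueToResidueC_apply (c : ResidueField (maxUnramifiedCompletion F)) :
    residueToResidueC F p c = tiltResidue F p (tiltMap p (toCInt₀ F) (residueTiltEquiv F p c)) := rfl

/-- `j` is injective (a ring map out of a field). [folklore] -/
theorem residueToResidueC_injective : Function.Injective (residueToResidueC F p) :=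
  (residueToResidueC F p).injective

/-- **`W(π) ∘ (W(k̄) → 𝔸_inf(F)) = W(j)`.** [cite: FontaineAsterisque223III, Exp. II §1.2] -/
theorem ainfResidue_wittToAinf (z : WittVector p (ResidueField (maxUnramifiedCompletion F))) :
    ainfResidue F p (wittToAinf F p z) = WittVector.map (residueToResidueC F p) z := by
  refine WittVector.ext fun n => ?_
  rw [coeff_ainfResidue, coeff_wittToAinf, WittVector.map_coeff, residueToResidueC_apply]

/-- **`j` is `Γ_F`-equivariant**: `j (σ̄ c) = σ̄_C (j c)` (equivariance of `ι₀` and of the tilt equivalence).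
[cite: FontaineAsterisque223III, Exp. II §1.2] -/
theorem residueToResidueC_residueGal (σ : absoluteGaloisGroup F) (c : ResidueField (maxUnramifiedCompletion F)) :
    residueToResidueC F p (residueGal σ c) = galResidueC σ (residueToResidueC F p c) := by
  rw [residueToResidueC_apply, residueToResidueC_apply, residueTiltEquiv_residueGal, ← tiltResidue_galTilt]
  congr 1
  change _ = tiltMap p (galInt σ) (tiltMap p (toCInt₀ F) (residueTiltEquiv F p c))
  rw [← tiltMap_comp_apply, ← tiltMap_comp_apply]
  exact tiltMap_congr (fun z => (galInt_toCInt₀ σ z).symm) _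

/-- `W(j)` is `Γ_F`-equivariant. [folklore] -/
theorem map_residueToResidueC_map_residueGal (σ : absoluteGaloisGroup F)
    (z : WittVector p (ResidueField (maxUnramifiedCompletion F))) :
    WittVector.map (residueToResidueC F p) (WittVector.map (residueGal σ) z) =
      WittVector.map (galResidueC σ) (WittVector.map (residueToResidueC F p) z) := by
  refine WittVector.ext fun n => ?_
  simp only [WittVector.map_coeff, residueToResidueC_residueGal]

/-- `W(j)` is injective. [folklore] -/
theorem map_residueToResidueC_injective :
    Function.Injective (WittVector.map (p := p) (residueToResidueC F p)) := fun x y h =>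
  WittVector.ext fun n => residueToResidueC_injective (by
    have := congrArg (fun w => WittVector.coeff w n) h
    simpa only [WittVector.map_coeff] using this)

/-- **Descent of `Γ_F`-invariance through `j`**: if `W(j) z` is fixed by `𝕎(σ̄_C)` then `z` is fixed by `𝕎(σ̄)`. [folklore] -/
theorem map_residueGal_eq_self_of_map (σ : absoluteGaloisGroup F) {z : WittVector p (ResidueField (maxUnramifiedCompletion F))}
    (h : WittVector.map (galResidueC σ) (WittVector.map (residueToResidueC F p) z) =
      WittVector.map (residueToResidueC F p) z) :
    WittVector.map (residueGal σ) z = z :=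
  map_residueToResidueC_injective (by rw [map_residueToResidueC_map_residueGal, h])

end Unramified

end SpecC

end Summit.Langlands.Langlands.Theorems

end
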